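import Summits.QuantumFields.BalabanUV.Beta.CompositeOneShotJetData
import Summits.QuantumFields.BalabanUV.Beta.CombOneShotJetsTabs
import Summits.QuantumFields.BalabanUV.Beta.OneShotJ1Split

/-!
# `BalabanUV.Beta.CompositeOneShotJ1Instance` — row D1 ∕ (C1), file F6d part 3: **THE (J1-COMP) SPLIT AT THE PAIR OF RECORD** — `OneShotJ1Split.hC1_of_tabs_and_comp`
# at `Jc := JcComp hLc N (cΛ 1) (cB 1) R P` and `Jt := JcOfTabs hLc N (fun k => symTablesAn1S2 3 (Lc^k) (cΛ k)) cΛ cB`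

WHAT ([folklore], two theorems, no definition):
* `TshotOf_JcComp_one_eq_JcOfTabs` — the depth-1 agreement `hone`: both one-shot kernels at depth `1` are ROOT M‴'s one-step kernel at level `0`
  (`CompositeOneShotJetData.TshotOf_JcComp_one`, `CombOneShotJets.TshotOf_JcOf_one`, `CombOneShotJetsTabs.JcOf_eq_JcOfTabs`), the depth-1 locks of `JcComp`
  being `(cΛ 1, cB 1)`.
* **`hC1_JcComp_of_JcOfTabs_and_comp`** — road «BF-x»'s row `hC₁` at the composite data OF RECORD from the same row at the one-shot-table family plus the
  displayed (J1-COMP) bound (F6D SPEC FINAL §4), for ANY road kernels `K m` with `AbsMoment₂` entries (hybrid, RE-TABLED (R-D1-g55-1), …), constant `CJ1 + CJ1′`.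
WHAT THIS IS NOT: (J1-COMP) and `hC₁[JcOfTabs]` stay DISPLAYED; nothing of Bałaban's asserted, valued or discharged; 0 estimates; 0∕4 row-D1 binders; RECORD unchanged;
NOT (C1) complete, NOT D1, NEVER «G-an2-4 closed», NOT BetaPertH, NOT continuum, NOT Clay.

HONEST DEPENDENCY (page 1, mandatory): continuum YM on T⁴ ⇐ BetaPertH ∧ nine spine estimates (0/9 proved); BetaPertH ⇐ (D1) ∧ (D4) ∧ CAP+tail;
G-an2-4 gates asym, D1 and NE2/3/4.  Row D1 ∕ (C1) OWNER an2, gen 55, 2026-08-24.  No existing file touched.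
-/

noncomputable section

namespace Summit.QuantumFields.BalabanUV.Beta.CompositeOneShotJ1Instance

open Literature.MathematicalPhysics.QuantumFieldTheory.Balaban1983to89
open Literature.MathematicalPhysics.QuantumFieldTheory.Balaban1983to89.Beta
open B12Beta (secondMoment)
open DressedMomentNormalisation (EKer)
open DecimatedMomentSummable (AbsMoment₂)
open OneStepKernelFamily (TshotOf)
open Summit.QuantumFields.BalabanUV.Beta.SymSecondOrderTablesAn1 (symTablesAn1S2)
open Summit.QuantumFields.BalabanUV.Beta.CombOneShotJets (JcOf TshotOf_JcOf_one)
open Summit.QuantumFields.BalabanUV.Beta.CombOneShotJetsTabs (JcOfTabs JcOf_eq_JcOfTabs)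
open Summit.QuantumFields.BalabanUV.Beta.CompositeOneShotJetData (Roots Pins JcComp TshotOf_JcComp_one)
open Summit.QuantumFields.BalabanUV.Beta.OneShotJ1Split (hC1_of_tabs_and_comp)

variable {Lc : ℕ} [NeZero Lc] (hLc : Odd Lc) (N : ℕ) (cΛ cB : ℕ → ℝ) (R : Roots Lc) (P : Pins)

/-- [folklore] **`hone` AT THE PAIR OF RECORD**: the composite data of record (depth-1 locks `cΛ 1, cB 1`) and the one-shot-table family over `symTablesAn1S2 3 (Lc^k) (cΛ k)`
have the SAME one-shot kernel at depth `1` — both are ROOT M‴'s one-step kernel at level `0`. -/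
theorem TshotOf_JcComp_one_eq_JcOfTabs :
    TshotOf Lc (JcComp hLc N (cΛ 1) (cB 1) R P) 1 = TshotOf Lc (JcOfTabs hLc N (fun k => symTablesAn1S2 3 (Lc ^ k) (cΛ k)) cΛ cB) 1 := by
  rw [TshotOf_JcComp_one, ← JcOf_eq_JcOfTabs, TshotOf_JcOf_one]

/-- [folklore] **`hC₁` AT THE COMPOSITE DATA OF RECORD FROM `hC₁` AT THE ONE-SHOT-TABLE FAMILY PLUS (J1-COMP)** (F6D SPEC FINAL §4; `OneShotJ1Split.hC1_of_tabs_and_comp`):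
road kernels `K m` with absolutely summable second moments for `m ≥ 1`; the row at `JcOfTabs …` with constant `CJ1`; the (J1-COMP) bound for `m ≥ 2` with constant
`CJ1′ ≥ 0`; conclusion = road «BF-x»'s END binder `hC₁` at `Jc := JcComp hLc N (cΛ 1) (cB 1) R P` with constant `CJ1 + CJ1′`. -/
theorem hC1_JcComp_of_JcOfTabs_and_comp (K : ℕ → EKer 4) {μ ν : Fin 4} {CJ1 CJ1' : ℝ}
    (hK : ∀ m : ℕ, 1 ≤ m → ∀ c e, AbsMoment₂ (K m c e)) (hCJ1' : 0 ≤ CJ1')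
    (htabs : ∀ m : ℕ, 1 ≤ m →
      |secondMoment (fun (c e : Fin 4) (z : Fin 4 → ℤ) =>
        TshotOf Lc (JcOfTabs hLc N (fun k => symTablesAn1S2 3 (Lc ^ k) (cΛ k)) cΛ cB) m c e z - K m c e z) μ ν| ≤ CJ1)
    (hcomp : ∀ m : ℕ, 2 ≤ m →
      |secondMoment (fun (c e : Fin 4) (z : Fin 4 → ℤ) =>
        TshotOf Lc (JcComp hLc N (cΛ 1) (cB 1) R P) m c e z
          - TshotOf Lc (JcOfTabs hLc N (fun k => symTablesAn1S2 3 (Lc ^ k) (cΛ k)) cΛ cB) m c e z) μ ν| ≤ CJ1') :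
    ∀ m : ℕ, 1 ≤ m →
      |secondMoment (fun (c e : Fin 4) (z : Fin 4 → ℤ) => TshotOf Lc (JcComp hLc N (cΛ 1) (cB 1) R P) m c e z - K m c e z) μ ν| ≤ CJ1 + CJ1' :=
  hC1_of_tabs_and_comp (JcComp hLc N (cΛ 1) (cB 1) R P) (JcOfTabs hLc N (fun k => symTablesAn1S2 3 (Lc ^ k) (cΛ k)) cΛ cB) K
    (TshotOf_JcComp_one_eq_JcOfTabs hLc N cΛ cB R P) hK hCJ1' htabs hcomp

end Summit.QuantumFields.BalabanUV.Beta.CompositeOneShotJ1Instance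

end
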